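import Summits.QuantumFields.YangMills.Theorems.PoincareLipschitzMinimiserDilationLetters
import HarnessLib

/-!
# Crux `BlockLipschitzL` (stmt-QuantumFields-23533) ∕ `HistoryTailL` (stmt-QuantumFields-19936), LINE 25 «CompactnessTransfer»,
# stub S1″ — the (TM) re-cut, file TM-B2 «THE VENDED CLASS IS DILATION-INVARIANT»

Cell `ym3-torus` (YM ladder rung R3 = continuum SU(2) Yang–Mills on T³ — a RUNG, NOT Clay: not d = 4, not infinite volume,
not a mass gap); WIDTH helper seat `ym3-torus-px3` g9 (LEAD ★w1-19936 g10 «GO (TM)» 14:49:45Z); `--supports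
stmt-QuantumFields-23533`; THEOREMS ONLY (0 `def`, 0 `sorry`, default heartbeats); imports TM-B1 ✓`…MinimiserDilationLetters`
(through it lit ✓`SobolevBallScaling`, ✓`MeyersSerrinProofs`, ✓`SobolevDomainProofs`, ✓`…LatticeToContinuumSobolevLetters`).

WHAT THIS FILE DOES.  (DIL) for the vended class of LINE 25 ∕ lit `HarmonicMapMinimisers` — finite-energy unit `W^{1,2}` maps
`U : Q → S³ ⊂ ℝ⁴` on the open unit cube `Q ⊂ ℝ³` with weak gradient `G`, minimising the Dirichlet energy on every ball
`B̄_ρ(y) ⊆ Q` against finite-energy unit competitors agreeing with `U` off a smaller concentric ball [Simon1996, §2.1]: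
* ★★★ `sMin_dilate (hS : ⟨SMin hQ U G⟩) (ht : 0 < t) (ht1 : t ≤ 1) : ⟨SMin hQ (U ∘ (t•)) (t•G ∘ (t•))⟩` — the rescaled map
  `U_t(x) = U(tx)` with gradient `G_t(x) = t•G(tx)` is again in the class.  Sobolev part: lit ✓`HasWeakFDerivOn.comp_affine` on
  `t⁻¹Q ⊇ Q` + restriction.  Minimality part (the content): a competitor `W` for `U_t` on `B̄_ρ(y) ⊆ Q` is transported to
  `W′(x) = W(t⁻¹x)`, which agrees with `U` off `B_{tρ″}(ty)` (`ρ″ = max(ρ′, ρ∕2)`); its weak gradient on `Q` is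
  `G + 1_{B_{tρ}(ty)}•(t⁻¹•GW(t⁻¹·) − G)` by TM-B1's ★★`hasWeakFDerivOn_extend_indicator` applied to `W′ − U` (Sobolev on
  `tQ`, zero off `B̄_{tρ″}(ty)`); minimality of `U` on `B̄_{tρ}(ty) ⊆ Q` and the two changes of variables
  (TM-B1 ★★`setIntegral_dens_dilate_ball` ∕ `…_inv_ball`) give `E(U_t; B_ρ(y)) = t⁻¹E(U; B_{tρ}(ty)) ≤ t⁻¹E(W′; B_{tρ}(ty)) = E(W; B_ρ(y))`.
* ★ `setIntegral_dens_dilate_unitCube` — `E(U_t; Q) = t⁻¹·E(U; Q_t)`, `Q_t = {|xᵢ| < t}` (the energy bound of the blow-up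
  sequence in TM-D comes from this and monotonicity).
HONEST SCOPE.  Class bookkeeping for the blow-up; nothing of (TM), (ZD), (C), S1″, K1, `MeanDeviationL`, `BlockLipschitzL`,
`HistoryTailL` is proved here.  YM₃ on T³ is rung R3, not Clay; YM gap NOT proved; no summit statement is proved here.

References: L. Simon, Theorems on Regularity and Singularity of Energy Minimizing Maps (1996) [Simon1996] (§2.1; §3.1 rescaled
maps `u_{y,λ}`); R. Schoen, K. Uhlenbeck, J. Differential Geom. 17 (1982) [SchoenUhlenbeck1982] (§2, scaling); L. C. Evans,
Partial Differential Equations (2010) [Evans2010] (§5.2.1).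
-/

set_option autoImplicit false

noncomputable section

open scoped BigOperators Topology
open MeasureTheory Set Filter Metric Function TopologicalSpace

namespace Summit.QuantumFields.YangMills.Theorems.PoincareLipschitzMinimiserDilation

open Literature.Analysis.FunctionSpaces (HasWeakFDerivOn affinePreimage coe_affinePreimage
  setIntegral_preimage_comp_affine)
open Literature.Analysis.FunctionSpaces.SobolevApprox (hasWeakFDerivOn_add)
open Summit.QuantumFields.YangMills.Theorems.PoincareLipschitzMinimiserDilationLetters

/-- ★ **CUBE ENERGY UNDER DILATION**: `∫_Q Σᵢ‖(t•G(tx)) eᵢ‖² dx = t⁻¹·∫_{Q_t} Σᵢ‖G eᵢ‖²`, `Q_t = {x | ∀ i, |xᵢ| < t}`, `t > 0`.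
[cite: Simon1996, §3.1 (rescaled maps)] -/
theorem setIntegral_dens_dilate_unitCube {t : ℝ} (ht : 0 < t)
    (G : EuclideanSpace ℝ (Fin 3) → (EuclideanSpace ℝ (Fin 3) →L[ℝ] EuclideanSpace ℝ (Fin 4))) :
    ∫ x in {x : EuclideanSpace ℝ (Fin 3) | ∀ i : Fin 3, |x i| < 1}, ∑ i : Fin 3, ‖(t • G (t • x)) (EuclideanSpace.single i (1:ℝ))‖ ^ 2 =
      t⁻¹ * ∫ x in {x : EuclideanSpace ℝ (Fin 3) | ∀ i : Fin 3, |x i| < t}, ∑ i : Fin 3, ‖G x (EuclideanSpace.single i (1:ℝ))‖ ^ 2 := by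
  have hpre : (fun x : EuclideanSpace ℝ (Fin 3) => (0 : EuclideanSpace ℝ (Fin 3)) + t • x) ⁻¹'
      {x : EuclideanSpace ℝ (Fin 3) | ∀ i : Fin 3, |x i| < t} = {x : EuclideanSpace ℝ (Fin 3) | ∀ i : Fin 3, |x i| < 1} := by
    ext x
    simp only [zero_add, mem_preimage, mem_setOf_eq, PiLp.smul_apply, smul_eq_mul, abs_mul, abs_of_pos ht]
    refine forall_congr' fun i => ?_
    constructor
    · intro h; nlinarith [abs_nonneg (x i)]
    · intro h; nlinarith [abs_nonneg (x i)]
  have hcv := setIntegral_preimage_comp_affine (F := ℝ) ht (0 : EuclideanSpace ℝ (Fin 3))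
    (fun x => ∑ i : Fin 3, ‖G x (EuclideanSpace.single i (1:ℝ))‖ ^ 2) {x : EuclideanSpace ℝ (Fin 3) | ∀ i : Fin 3, |x i| < t}
  rw [hpre] at hcv
  simp only [zero_add, smul_eq_mul, finrank_euclideanSpace_fin] at hcv
  simp_rw [dens_smul]
  rw [integral_const_mul, hcv, ← mul_assoc]
  congr 1
  rw [show (t ^ 3)⁻¹ = t⁻¹ * (t⁻¹ * t⁻¹) by rw [← mul_inv, ← mul_inv]; ring_nf]
  field_simp

/-- ★★★ **THE VENDED CLASS IS DILATION-INVARIANT.**  If `(U, G)` is a finite-energy unit `W^{1,2}` map `Q → S³` minimising the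
Dirichlet energy on every ball `B̄_ρ(y) ⊆ Q` against finite-energy unit competitors agreeing with it off a smaller concentric ball
[Simon1996, §2.1], then so is `(U ∘ (t•), t•G ∘ (t•))` for `0 < t ≤ 1`.  The minimality transfers by transporting a competitor
`W` for `U_t` on `B̄_ρ(y)` to the competitor `W(t⁻¹·)` for `U` on `B̄_{tρ}(ty) ⊆ Q` (weak gradient on `Q` by TM-B1's
★★`hasWeakFDerivOn_extend_indicator`) and changing variables in the ball energies. [cite: Simon1996, §2.1 and §3.1; SchoenUhlenbeck1982, §2] -/
theorem sMin_dilate (hQ : IsOpen {x : EuclideanSpace ℝ (Fin 3) | ∀ i : Fin 3, |x i| < 1})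
    {U : EuclideanSpace ℝ (Fin 3) → EuclideanSpace ℝ (Fin 4)} {G : EuclideanSpace ℝ (Fin 3) → (EuclideanSpace ℝ (Fin 3) →L[ℝ] EuclideanSpace ℝ (Fin 4))}
    (hS :
      (HasWeakFDerivOn ⟨{x : EuclideanSpace ℝ (Fin 3) | ∀ i : Fin 3, |x i| < 1}, hQ⟩ volume U G ∧
        (∀ x : EuclideanSpace ℝ (Fin 3), (∀ i : Fin 3, |x i| < 1) → ‖U x‖ = 1) ∧
        IntegrableOn (fun x => ∑ i : Fin 3, ‖G x (EuclideanSpace.single i (1:ℝ))‖ ^ 2) {x : EuclideanSpace ℝ (Fin 3) | ∀ i : Fin 3, |x i| < 1} ∧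
        (∀ (y : EuclideanSpace ℝ (Fin 3)) (ρ : ℝ), 0 < ρ → closedBall y ρ ⊆ {x : EuclideanSpace ℝ (Fin 3) | ∀ i : Fin 3, |x i| < 1} →
          ∀ (W : EuclideanSpace ℝ (Fin 3) → EuclideanSpace ℝ (Fin 4)) (GW : EuclideanSpace ℝ (Fin 3) → (EuclideanSpace ℝ (Fin 3) →L[ℝ] EuclideanSpace ℝ (Fin 4))),
          HasWeakFDerivOn ⟨{x : EuclideanSpace ℝ (Fin 3) | ∀ i : Fin 3, |x i| < 1}, hQ⟩ volume W GW →
          (∀ x : EuclideanSpace ℝ (Fin 3), (∀ i : Fin 3, |x i| < 1) → ‖W x‖ = 1) →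
          IntegrableOn (fun x => ∑ i : Fin 3, ‖GW x (EuclideanSpace.single i (1:ℝ))‖ ^ 2) {x : EuclideanSpace ℝ (Fin 3) | ∀ i : Fin 3, |x i| < 1} →
          (∃ ρ' : ℝ, ρ' < ρ ∧ ∀ x : EuclideanSpace ℝ (Fin 3), x ∉ ball y ρ' → W x = U x) →
          ∫ x in ball y ρ, ∑ i : Fin 3, ‖G x (EuclideanSpace.single i (1:ℝ))‖ ^ 2 ≤ ∫ x in ball y ρ, ∑ i : Fin 3, ‖GW x (EuclideanSpace.single i (1:ℝ))‖ ^ 2)))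
    {t : ℝ} (ht : 0 < t) (ht1 : t ≤ 1) :
      (HasWeakFDerivOn ⟨{x : EuclideanSpace ℝ (Fin 3) | ∀ i : Fin 3, |x i| < 1}, hQ⟩ volume (fun x => U (t • x)) (fun x => t • G (t • x)) ∧
        (∀ x : EuclideanSpace ℝ (Fin 3), (∀ i : Fin 3, |x i| < 1) → ‖U (t • x)‖ = 1) ∧
        IntegrableOn (fun x => ∑ i : Fin 3, ‖(t • G (t • x)) (EuclideanSpace.single i (1:ℝ))‖ ^ 2) {x : EuclideanSpace ℝ (Fin 3) | ∀ i : Fin 3, |x i| < 1} ∧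
        (∀ (y : EuclideanSpace ℝ (Fin 3)) (ρ : ℝ), 0 < ρ → closedBall y ρ ⊆ {x : EuclideanSpace ℝ (Fin 3) | ∀ i : Fin 3, |x i| < 1} →
          ∀ (W : EuclideanSpace ℝ (Fin 3) → EuclideanSpace ℝ (Fin 4)) (GW : EuclideanSpace ℝ (Fin 3) → (EuclideanSpace ℝ (Fin 3) →L[ℝ] EuclideanSpace ℝ (Fin 4))),
          HasWeakFDerivOn ⟨{x : EuclideanSpace ℝ (Fin 3) | ∀ i : Fin 3, |x i| < 1}, hQ⟩ volume W GW →
          (∀ x : EuclideanSpace ℝ (Fin 3), (∀ i : Fin 3, |x i| < 1) → ‖W x‖ = 1) →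
          IntegrableOn (fun x => ∑ i : Fin 3, ‖GW x (EuclideanSpace.single i (1:ℝ))‖ ^ 2) {x : EuclideanSpace ℝ (Fin 3) | ∀ i : Fin 3, |x i| < 1} →
          (∃ ρ' : ℝ, ρ' < ρ ∧ ∀ x : EuclideanSpace ℝ (Fin 3), x ∉ ball y ρ' → W x = U (t • x)) →
          ∫ x in ball y ρ, ∑ i : Fin 3, ‖(t • G (t • x)) (EuclideanSpace.single i (1:ℝ))‖ ^ 2 ≤ ∫ x in ball y ρ, ∑ i : Fin 3, ‖GW x (EuclideanSpace.single i (1:ℝ))‖ ^ 2)) := by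
  obtain ⟨hU, hU1, hGi, hmin⟩ := hS
  -- §a the Sobolev row: `comp_affine` on `t⁻¹Q ⊇ Q`, restricted to `Q`
  have hQle : (⟨{x : EuclideanSpace ℝ (Fin 3) | ∀ i : Fin 3, |x i| < 1}, hQ⟩ : Opens (EuclideanSpace ℝ (Fin 3))) ≤
      affinePreimage t 0 ⟨{x : EuclideanSpace ℝ (Fin 3) | ∀ i : Fin 3, |x i| < 1}, hQ⟩ := by
    intro x hx
    show (0 : EuclideanSpace ℝ (Fin 3)) + t • x ∈ {x : EuclideanSpace ℝ (Fin 3) | ∀ i : Fin 3, |x i| < 1}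
    rw [zero_add]; exact smul_mem_unitCube ht ht1 hx
  have hUt : HasWeakFDerivOn ⟨{x : EuclideanSpace ℝ (Fin 3) | ∀ i : Fin 3, |x i| < 1}, hQ⟩ volume (fun x => U (t • x)) (fun x => t • G (t • x)) := by
    have h1 := Literature.Analysis.FunctionSpaces.HasWeakFDerivOn.mono_set_holds (hU.comp_affine ht 0) hQle
    have e1 : (fun y : EuclideanSpace ℝ (Fin 3) => U ((0 : EuclideanSpace ℝ (Fin 3)) + t • y)) = fun y => U (t • y) := by
      funext y; rw [zero_add]
    have e2 : (fun y : EuclideanSpace ℝ (Fin 3) => t • G ((0 : EuclideanSpace ℝ (Fin 3)) + t • y)) = fun y => t • G (t • y) := by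
      funext y; rw [zero_add]
    rw [e1, e2] at h1
    exact h1
  -- §b the energy row
  have hGti : IntegrableOn (fun x => ∑ i : Fin 3, ‖(t • G (t • x)) (EuclideanSpace.single i (1:ℝ))‖ ^ 2)
      {x : EuclideanSpace ℝ (Fin 3) | ∀ i : Fin 3, |x i| < 1} := by
    have hm : MemLp (fun x => ∑ i : Fin 3, ‖G x (EuclideanSpace.single i (1:ℝ))‖ ^ 2) 1
        (volume.restrict {x : EuclideanSpace ℝ (Fin 3) | ∀ i : Fin 3, |x i| < 1}) := memLp_one_iff_integrable.2 hGi
    have hm2 := Literature.Analysis.FunctionSpaces.MemLp.comp_affine ht (0 : EuclideanSpace ℝ (Fin 3)) hm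
    have hint : IntegrableOn (fun y => ∑ i : Fin 3, ‖G ((0 : EuclideanSpace ℝ (Fin 3)) + t • y) (EuclideanSpace.single i (1:ℝ))‖ ^ 2)
        ((fun y : EuclideanSpace ℝ (Fin 3) => (0 : EuclideanSpace ℝ (Fin 3)) + t • y) ⁻¹' {x : EuclideanSpace ℝ (Fin 3) | ∀ i : Fin 3, |x i| < 1}) :=
      memLp_one_iff_integrable.1 hm2
    have hint' : IntegrableOn (fun y => ∑ i : Fin 3, ‖G (t • y) (EuclideanSpace.single i (1:ℝ))‖ ^ 2)
        {x : EuclideanSpace ℝ (Fin 3) | ∀ i : Fin 3, |x i| < 1} := by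
      exact (hint.mono_set hQle).congr_fun (fun x _ => by simp only [zero_add]) hQ.measurableSet
    have e : (fun x => ∑ i : Fin 3, ‖(t • G (t • x)) (EuclideanSpace.single i (1:ℝ))‖ ^ 2) =
        fun x => t ^ 2 * ∑ i : Fin 3, ‖G (t • x) (EuclideanSpace.single i (1:ℝ))‖ ^ 2 := funext fun x => dens_smul t (G (t • x))
    rw [e]
    exact hint'.const_mul (t ^ 2)
  refine ⟨hUt, fun x hx => hU1 (t • x) (smul_mem_unitCube ht ht1 hx), hGti, ?_⟩
  -- §c the minimality row
  intro y ρ hρ hyρ W GW hW hW1 hGWi hWU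
  obtain ⟨ρ', hρ'ρ, hWU⟩ := hWU
  -- a positive inner radius
  set ρ'' : ℝ := max ρ' (ρ / 2) with hρ''_def
  have hρ''pos : 0 < ρ'' := lt_max_of_lt_right (by linarith)
  have hρ''lt : ρ'' < ρ := max_lt hρ'ρ (by linarith)
  have hWU'' : ∀ x : EuclideanSpace ℝ (Fin 3), x ∉ ball y ρ'' → W x = U (t • x) :=
    fun x hx => hWU x fun h => hx (ball_subset_ball (le_max_left _ _) h)
  have hti : 0 < t⁻¹ := inv_pos.2 ht
  have htρ : 0 < t * ρ := mul_pos ht hρ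
  have htρ'' : t * ρ'' < t * ρ := mul_lt_mul_of_pos_left hρ''lt ht
  -- distances under `t⁻¹•`
  have hdist : ∀ x : EuclideanSpace ℝ (Fin 3), dist (t⁻¹ • x) y = t⁻¹ * dist x (t • y) := by
    intro x
    conv_rhs => rw [show x = t • (t⁻¹ • x) by rw [smul_smul, mul_inv_cancel₀ ht.ne', one_smul]]
    rw [dist_smul₀, Real.norm_eq_abs, abs_of_pos ht, ← mul_assoc, inv_mul_cancel₀ ht.ne', one_mul]
  -- the transported competitor and its pieces
  set W' : EuclideanSpace ℝ (Fin 3) → EuclideanSpace ℝ (Fin 4) := fun x => W (t⁻¹ • x) with hW'_def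
  set H : EuclideanSpace ℝ (Fin 3) → (EuclideanSpace ℝ (Fin 3) →L[ℝ] EuclideanSpace ℝ (Fin 4)) := fun x => t⁻¹ • GW (t⁻¹ • x) with hH_def
  set B : Set (EuclideanSpace ℝ (Fin 3)) := ball (t • y) (t * ρ) with hB_def
  set Qt : Opens (EuclideanSpace ℝ (Fin 3)) := affinePreimage t⁻¹ 0 ⟨{x : EuclideanSpace ℝ (Fin 3) | ∀ i : Fin 3, |x i| < 1}, hQ⟩ with hQt_def
  have hQt_mem : ∀ x : EuclideanSpace ℝ (Fin 3), x ∈ (Qt : Set (EuclideanSpace ℝ (Fin 3))) ↔ ∀ i : Fin 3, |(t⁻¹ • x) i| < 1 := by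
    intro x
    show (0 : EuclideanSpace ℝ (Fin 3)) + t⁻¹ • x ∈ {x : EuclideanSpace ℝ (Fin 3) | ∀ i : Fin 3, |x i| < 1} ↔ _
    rw [zero_add]; rfl
  have hQtQ : Qt ≤ (⟨{x : EuclideanSpace ℝ (Fin 3) | ∀ i : Fin 3, |x i| < 1}, hQ⟩ : Opens (EuclideanSpace ℝ (Fin 3))) :=
    fun x hx => mem_unitCube_of_inv_smul_mem ht ht1 ((hQt_mem x).1 hx)
  have hcBQt : closedBall (t • y) (t * ρ) ⊆ (Qt : Set (EuclideanSpace ℝ (Fin 3))) := by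
    intro x hx
    refine (hQt_mem x).2 (hyρ (mem_closedBall.2 ?_))
    rw [hdist x]
    have := mem_closedBall.1 hx
    calc t⁻¹ * dist x (t • y) ≤ t⁻¹ * (t * ρ) := mul_le_mul_of_nonneg_left this hti.le
      _ = ρ := by rw [← mul_assoc, inv_mul_cancel₀ ht.ne', one_mul]
  have hcBQ : closedBall (t • y) (t * ρ) ⊆ {x : EuclideanSpace ℝ (Fin 3) | ∀ i : Fin 3, |x i| < 1} := fun x hx => hQtQ (hcBQt hx)
  -- `W'` is Sobolev on `Qt` with gradient `H`
  have hW'Qt : HasWeakFDerivOn Qt volume W' H := by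
    have h1 := hW.comp_affine hti (0 : EuclideanSpace ℝ (Fin 3))
    have e1 : (fun y : EuclideanSpace ℝ (Fin 3) => W ((0 : EuclideanSpace ℝ (Fin 3)) + t⁻¹ • y)) = W' := by funext y; rw [zero_add]
    have e2 : (fun y : EuclideanSpace ℝ (Fin 3) => t⁻¹ • GW ((0 : EuclideanSpace ℝ (Fin 3)) + t⁻¹ • y)) = H := by funext y; rw [zero_add]
    rw [e1, e2] at h1
    exact h1
  have hUQt : HasWeakFDerivOn Qt volume U G := Literature.Analysis.FunctionSpaces.HasWeakFDerivOn.mono_set_holds hU hQtQ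
  have hD : HasWeakFDerivOn Qt volume (W' - U) (H - G) := hW'Qt.sub hUQt
  -- `W' = U` off `B_{tρ''}(ty)`
  have hzero : ∀ x : EuclideanSpace ℝ (Fin 3), t * ρ'' ≤ dist x (t • y) → (W' - U) x = 0 := by
    intro x hx
    have hx' : t⁻¹ • x ∉ ball y ρ'' := by
      rw [mem_ball, not_lt, hdist x]
      calc ρ'' = t⁻¹ * (t * ρ'') := by rw [← mul_assoc, inv_mul_cancel₀ ht.ne', one_mul]
        _ ≤ t⁻¹ * dist x (t • y) := mul_le_mul_of_nonneg_left hx hti.le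
    have h := hWU'' _ hx'
    rw [smul_smul, mul_inv_cancel₀ ht.ne', one_smul] at h
    simp [hW'_def, h]
  -- the weak gradient of `W'` on `Q`
  have hDQ : HasWeakFDerivOn ⟨{x : EuclideanSpace ℝ (Fin 3) | ∀ i : Fin 3, |x i| < 1}, hQ⟩ volume (W' - U) (B.indicator (H - G)) :=
    hasWeakFDerivOn_extend_indicator hD (mul_pos ht hρ''pos) htρ'' hcBQt hzero
      (closedBall_subset_ball htρ'') Subset.rfl _
  have hW'Q : HasWeakFDerivOn ⟨{x : EuclideanSpace ℝ (Fin 3) | ∀ i : Fin 3, |x i| < 1}, hQ⟩ volume W' (G + B.indicator (H - G)) := by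
    have h := hasWeakFDerivOn_add hU hDQ
    have e : U + (W' - U) = W' := by funext x; simp
    rw [e] at h
    exact h
  -- unit on `Q`
  have hW'1 : ∀ x : EuclideanSpace ℝ (Fin 3), (∀ i : Fin 3, |x i| < 1) → ‖W' x‖ = 1 := by
    intro x hx
    by_cases hxd : t * ρ'' ≤ dist x (t • y)
    · have h := hzero x hxd
      rw [Pi.sub_apply, sub_eq_zero] at h
      rw [h]; exact hU1 x hx
    · have hxQ : ∀ i : Fin 3, |(t⁻¹ • x) i| < 1 := by
        refine ball_subset_closedBall.trans hyρ (mem_ball.2 ?_) |> fun h => h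
        rw [hdist x]
        calc t⁻¹ * dist x (t • y) < t⁻¹ * (t * ρ) := mul_lt_mul_of_pos_left ((not_le.1 hxd).trans htρ'') hti
          _ = ρ := by rw [← mul_assoc, inv_mul_cancel₀ ht.ne', one_mul]
      exact hW1 _ hxQ
  -- integrable energy on `Q`
  have hGW'i : IntegrableOn (fun x => ∑ i : Fin 3, ‖(G + B.indicator (H - G)) x (EuclideanSpace.single i (1:ℝ))‖ ^ 2)
      {x : EuclideanSpace ℝ (Fin 3) | ∀ i : Fin 3, |x i| < 1} := by
    -- on `B`: the density of `H`
    have hm : MemLp (fun x => ∑ i : Fin 3, ‖GW x (EuclideanSpace.single i (1:ℝ))‖ ^ 2) 1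
        (volume.restrict {x : EuclideanSpace ℝ (Fin 3) | ∀ i : Fin 3, |x i| < 1}) := memLp_one_iff_integrable.2 hGWi
    have hm2 := Literature.Analysis.FunctionSpaces.MemLp.comp_affine hti (0 : EuclideanSpace ℝ (Fin 3)) hm
    have hint : IntegrableOn (fun y => ∑ i : Fin 3, ‖GW ((0 : EuclideanSpace ℝ (Fin 3)) + t⁻¹ • y) (EuclideanSpace.single i (1:ℝ))‖ ^ 2)
        (Qt : Set (EuclideanSpace ℝ (Fin 3))) := memLp_one_iff_integrable.1 hm2
    have hHB : IntegrableOn (fun x => ∑ i : Fin 3, ‖H x (EuclideanSpace.single i (1:ℝ))‖ ^ 2) B := by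
      have h1 : IntegrableOn (fun y => ∑ i : Fin 3, ‖GW (t⁻¹ • y) (EuclideanSpace.single i (1:ℝ))‖ ^ 2) B :=
        (hint.mono_set (ball_subset_closedBall.trans hcBQt)).congr_fun (fun x _ => by simp only [zero_add]) measurableSet_ball
      have e : (fun x => ∑ i : Fin 3, ‖H x (EuclideanSpace.single i (1:ℝ))‖ ^ 2) =
          fun x => t⁻¹ ^ 2 * ∑ i : Fin 3, ‖GW (t⁻¹ • x) (EuclideanSpace.single i (1:ℝ))‖ ^ 2 := funext fun x => dens_smul t⁻¹ (GW (t⁻¹ • x))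
      rw [e]; exact h1.const_mul _
    have hpB : IntegrableOn (fun x => ∑ i : Fin 3, ‖(G + B.indicator (H - G)) x (EuclideanSpace.single i (1:ℝ))‖ ^ 2)
        ({x : EuclideanSpace ℝ (Fin 3) | ∀ i : Fin 3, |x i| < 1} ∩ B) := by
      refine (hHB.mono_set inter_subset_right).congr_fun (fun x hx => ?_) (hQ.measurableSet.inter measurableSet_ball)
      simp only [Pi.add_apply, indicator_of_mem hx.2, Pi.sub_apply, add_sub_cancel]
    have hpC : IntegrableOn (fun x => ∑ i : Fin 3, ‖(G + B.indicator (H - G)) x (EuclideanSpace.single i (1:ℝ))‖ ^ 2)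
        ({x : EuclideanSpace ℝ (Fin 3) | ∀ i : Fin 3, |x i| < 1} \ B) := by
      refine (hGi.mono_set sdiff_subset).congr_fun (fun x hx => ?_) (hQ.measurableSet.diff measurableSet_ball)
      simp only [Pi.add_apply, indicator_of_notMem hx.2, add_zero]
    rw [← inter_union_sdiff {x : EuclideanSpace ℝ (Fin 3) | ∀ i : Fin 3, |x i| < 1} B]
    exact hpB.union hpC
  -- minimality of `U` on `B̄_{tρ}(ty) ⊆ Q` against `W'`
  have hmin' := hmin (t • y) (t * ρ) htρ hcBQ W' (G + B.indicator (H - G)) hW'Q hW'1 hGW'i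
    ⟨t * ρ'', htρ'', fun x hx => by
      have h := hzero x (by rwa [mem_ball, not_lt] at hx)
      rwa [Pi.sub_apply, sub_eq_zero] at h⟩
  -- the competitor's energy on `B` is that of `H`, i.e. `t·E(W; B_ρ(y))`
  have hEB : ∫ x in B, ∑ i : Fin 3, ‖(G + B.indicator (H - G)) x (EuclideanSpace.single i (1:ℝ))‖ ^ 2 =
      ∫ x in B, ∑ i : Fin 3, ‖H x (EuclideanSpace.single i (1:ℝ))‖ ^ 2 := by
    refine setIntegral_congr_fun measurableSet_ball fun x hx => ?_
    simp only [Pi.add_apply, indicator_of_mem hx, Pi.sub_apply, add_sub_cancel]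
  have hEH : ∫ x in B, ∑ i : Fin 3, ‖H x (EuclideanSpace.single i (1:ℝ))‖ ^ 2 =
      t * ∫ x in ball y ρ, ∑ i : Fin 3, ‖GW x (EuclideanSpace.single i (1:ℝ))‖ ^ 2 := setIntegral_dens_dilate_inv_ball ht GW y ρ
  have hEU : ∫ x in ball y ρ, ∑ i : Fin 3, ‖(t • G (t • x)) (EuclideanSpace.single i (1:ℝ))‖ ^ 2 =
      t⁻¹ * ∫ x in B, ∑ i : Fin 3, ‖G x (EuclideanSpace.single i (1:ℝ))‖ ^ 2 := setIntegral_dens_dilate_ball ht G y ρ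
  rw [hEU]
  calc t⁻¹ * ∫ x in B, ∑ i : Fin 3, ‖G x (EuclideanSpace.single i (1:ℝ))‖ ^ 2
      ≤ t⁻¹ * ∫ x in B, ∑ i : Fin 3, ‖(G + B.indicator (H - G)) x (EuclideanSpace.single i (1:ℝ))‖ ^ 2 :=
        mul_le_mul_of_nonneg_left hmin' hti.le
    _ = ∫ x in ball y ρ, ∑ i : Fin 3, ‖GW x (EuclideanSpace.single i (1:ℝ))‖ ^ 2 := by
        rw [hEB, hEH, ← mul_assoc, inv_mul_cancel₀ ht.ne', one_mul]

end Summit.QuantumFields.YangMills.Theorems.PoincareLipschitzMinimiserDilation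

end
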